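import Summits.Parity.GeneralizedHardyLittlewood.Theorems.FordMaynardSieveConst01651SieveConst01651PairingTwoPlane
import Summits.Parity.GeneralizedHardyLittlewood.Theorems.FordMaynardSieveConst01651SieveConst01651RectSound
import Summits.Parity.GeneralizedHardyLittlewood.Theorems.FordMaynardSieveConst01651SieveConst01651PlaneSymm
import HarnessLib

/-!
# Route `FordMaynardSieveConst01651`, target `SieveConst01651` (stmt-Parity-19185), stub `stub_certValuePos` (R2):
# the cell region of a `g₂` entry in the `(y₁, y₂)`-plane

Def-free helper file (glue (Ga)–(Gc) of the `certP`/`certN` soundness, see `…CertAssembly`).  For a table entry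
`e = (a, b, j, c)` the plane integral of `…PairingTwoPlane.entryPairing_eq_plane` lives on the region

  `Q_e = {e_a < y₁ < e_{a+1}, e_b < y₂ < e_{b+1}, y₁ ≤ y₂, band_j(y₁ + y₂), y₁ + y₂ < 1/2}`;

dropping `y₁ ≤ y₂` gives the swap-friendly region `S_e`.  Recorded here: measurability of both, `Q_e = S_e ∩ {y₁ ≤ y₂}`,
`S_e ⊆ [ν₀,1)²`, integrability on `S_e` of the truncated weight `f(y) = Ψ(y₁+y₂)/(y₁y₂)`
(`Ψ(s) = 𝟙[0 ≤ s ≤ 1] Φ₆(1−s)`, the integrand of `…RectSound`), the plane integral as `κ ∫_{Q_e} f`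
(`plane_eq_mul_setIntegral`), and the weight identity `∫_{S_e} f = σ_e ∫_{Q_e} f` with `σ_e = 2` on the diagonal
cells `a = b` (swap symmetry, `…PlaneSymm`) and `σ_e = 1` for `a < b` (then `S_e = Q_e`) (`setIntegral_entrySq_eq`).

References: folklore; [FordMaynard2024PrimeSieves] arXiv:2407.14368, §8.2 (the `g₂` cells).
-/

noncomputable section

open MeasureTheory Set
open scoped Classical
open Literature.NumberTheory.Sieve Literature.NumberTheory.Sieve.FordMaynard
open Literature.Analysis.Convolution

namespace Summit.Parity.GeneralizedHardyLittlewood.FordMaynardSieveConst01651SieveConst01651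

/-! ### Table facts -/

/-- For a table entry: `a ≤ b ≤ 71` and `j ≤ 1`. [folklore] -/
theorem certG2_le_of_mem {e : ℕ × ℕ × ℕ × ℤ} (he : e ∈ certG2) : e.1 ≤ e.2.1 ∧ e.2.1 ≤ 71 ∧ e.2.2.1 ≤ 1 := by
  have h := certG2_fst_le
  rw [List.all_eq_true] at h
  have h1 := h e he
  simp only [decide_eq_true_eq] at h1
  exact ⟨h1.2.1, (certG2_key_small he).2.1, h1.2.2.2⟩

/-- Monotonicity of the edges (real cast, non-strict). [folklore] -/
theorem certEdge_cast_le {a b : ℕ} (hab : a ≤ b) (hb : b ≤ 85) :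
    ((certEdge a : ℚ) : ℝ) ≤ ((certEdge b : ℚ) : ℝ) := by
  rcases eq_or_lt_of_le hab with h | h
  · rw [h]
  · exact (certEdge_cast_lt h hb).le

/-! ### The two regions -/

/-- `S_e` is measurable. [folklore] -/
theorem measurableSet_entrySq (e : ℕ × ℕ × ℕ × ℤ) :
    MeasurableSet {y : ℝ × ℝ | ((certEdge e.1 : ℚ) : ℝ) < y.1 ∧ y.1 < ((certEdge (e.1 + 1) : ℚ) : ℝ) ∧
      ((certEdge e.2.1 : ℚ) : ℝ) < y.2 ∧ y.2 < ((certEdge (e.2.1 + 1) : ℚ) : ℝ) ∧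
      (if e.2.2.1 = 0 then y.1 + y.2 < 8349 / 20000 else 8349 / 20000 < y.1 + y.2) ∧ y.1 + y.2 < 1 / 2} := by
  have h1 : Measurable fun y : ℝ × ℝ => y.1 := measurable_fst
  have h2 : Measurable fun y : ℝ × ℝ => y.2 := measurable_snd
  have hs : Measurable fun y : ℝ × ℝ => y.1 + y.2 := measurable_fst.add measurable_snd
  have hb : MeasurableSet {y : ℝ × ℝ | (if e.2.2.1 = 0 then y.1 + y.2 < 8349 / 20000 else 8349 / 20000 < y.1 + y.2)} := by
    by_cases hj : e.2.2.1 = 0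
    · simp only [hj, if_true]; exact measurableSet_lt hs measurable_const
    · simp only [hj, if_false]; exact measurableSet_lt measurable_const hs
  simp only [Set.setOf_and]
  exact (measurableSet_lt measurable_const h1).inter ((measurableSet_lt h1 measurable_const).inter
    ((measurableSet_lt measurable_const h2).inter ((measurableSet_lt h2 measurable_const).inter
    (hb.inter (measurableSet_lt hs measurable_const)))))

/-- `Q_e` is measurable. [folklore] -/
theorem measurableSet_entryQ (e : ℕ × ℕ × ℕ × ℤ) :
    MeasurableSet {y : ℝ × ℝ | ((certEdge e.1 : ℚ) : ℝ) < y.1 ∧ y.1 < ((certEdge (e.1 + 1) : ℚ) : ℝ) ∧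
      ((certEdge e.2.1 : ℚ) : ℝ) < y.2 ∧ y.2 < ((certEdge (e.2.1 + 1) : ℚ) : ℝ) ∧
      y.1 ≤ y.2 ∧ (if e.2.2.1 = 0 then y.1 + y.2 < 8349 / 20000 else 8349 / 20000 < y.1 + y.2) ∧
      y.1 + y.2 < 1 / 2} := by
  have h1 : Measurable fun y : ℝ × ℝ => y.1 := measurable_fst
  have h2 : Measurable fun y : ℝ × ℝ => y.2 := measurable_snd
  have hs : Measurable fun y : ℝ × ℝ => y.1 + y.2 := measurable_fst.add measurable_snd
  have hb : MeasurableSet {y : ℝ × ℝ | (if e.2.2.1 = 0 then y.1 + y.2 < 8349 / 20000 else 8349 / 20000 < y.1 + y.2)} := by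
    by_cases hj : e.2.2.1 = 0
    · simp only [hj, if_true]; exact measurableSet_lt hs measurable_const
    · simp only [hj, if_false]; exact measurableSet_lt measurable_const hs
  simp only [Set.setOf_and]
  exact (measurableSet_lt measurable_const h1).inter ((measurableSet_lt h1 measurable_const).inter
    ((measurableSet_lt measurable_const h2).inter ((measurableSet_lt h2 measurable_const).inter
    ((measurableSet_le h1 h2).inter (hb.inter (measurableSet_lt hs measurable_const))))))

/-- `Q_e = S_e ∩ {y₁ ≤ y₂}`. [folklore] -/
theorem entryQ_eq_inter (e : ℕ × ℕ × ℕ × ℤ) :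
    {y : ℝ × ℝ | ((certEdge e.1 : ℚ) : ℝ) < y.1 ∧ y.1 < ((certEdge (e.1 + 1) : ℚ) : ℝ) ∧
      ((certEdge e.2.1 : ℚ) : ℝ) < y.2 ∧ y.2 < ((certEdge (e.2.1 + 1) : ℚ) : ℝ) ∧
      y.1 ≤ y.2 ∧ (if e.2.2.1 = 0 then y.1 + y.2 < 8349 / 20000 else 8349 / 20000 < y.1 + y.2) ∧
      y.1 + y.2 < 1 / 2} =
    {y : ℝ × ℝ | ((certEdge e.1 : ℚ) : ℝ) < y.1 ∧ y.1 < ((certEdge (e.1 + 1) : ℚ) : ℝ) ∧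
      ((certEdge e.2.1 : ℚ) : ℝ) < y.2 ∧ y.2 < ((certEdge (e.2.1 + 1) : ℚ) : ℝ) ∧
      (if e.2.2.1 = 0 then y.1 + y.2 < 8349 / 20000 else 8349 / 20000 < y.1 + y.2) ∧ y.1 + y.2 < 1 / 2} ∩ {y : ℝ × ℝ | y.1 ≤ y.2} := by
  ext y
  simp only [Set.mem_setOf_eq, Set.mem_inter_iff]
  tauto

/-- `S_e ⊆ [ν₀, 1) × [ν₀, 1)`. [folklore] -/
theorem entrySq_subset (e : ℕ × ℕ × ℕ × ℤ) :
    {y : ℝ × ℝ | ((certEdge e.1 : ℚ) : ℝ) < y.1 ∧ y.1 < ((certEdge (e.1 + 1) : ℚ) : ℝ) ∧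
      ((certEdge e.2.1 : ℚ) : ℝ) < y.2 ∧ y.2 < ((certEdge (e.2.1 + 1) : ℚ) : ℝ) ∧
      (if e.2.2.1 = 0 then y.1 + y.2 < 8349 / 20000 else 8349 / 20000 < y.1 + y.2) ∧ y.1 + y.2 < 1 / 2} ⊆
    Set.Ico (1651 / 10000 : ℝ) 1 ×ˢ Set.Ico (1651 / 10000 : ℝ) 1 := by
  intro y hy
  simp only [Set.mem_setOf_eq] at hy
  obtain ⟨h1, -, h3, -, -, h6⟩ := hy
  have ha := nu_le_certEdge e.1
  have hb := nu_le_certEdge e.2.1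
  have hy1 : (1651 / 10000 : ℝ) < y.1 := lt_of_le_of_lt ha h1
  have hy2 : (1651 / 10000 : ℝ) < y.2 := lt_of_le_of_lt hb h3
  exact ⟨⟨hy1.le, by linarith⟩, ⟨hy2.le, by linarith⟩⟩

/-! ### The truncated weight `f(y) = Ψ(y₁ + y₂)/(y₁ y₂)` -/

/-- `f ≥ 0` in the open quadrant. [folklore] -/
theorem truncWeight_nonneg (y : ℝ × ℝ) (h1 : 0 < y.1) (h2 : 0 < y.2) :
    0 ≤ (if 0 ≤ y.1 + y.2 ∧ y.1 + y.2 ≤ 1 then ∑ k ∈ Finset.Icc 1 6, (1 / (k.factorial : ℝ)) *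
            cpow (fun t : ℝ => if (1651 / 10000 : ℝ) < t then 1 / t else 0) k (1 - (y.1 + y.2)) else 0) /
            (y.1 * y.2) := by
  refine div_nonneg ?_ (mul_pos h1 h2).le
  split_ifs
  · exact buchstabPhi_nonneg (by norm_num) 6 _
  · exact le_rfl

/-- `f` is swap-invariant. [folklore] -/
theorem truncWeight_swap (y : ℝ × ℝ) :
    (fun y : ℝ × ℝ => (if 0 ≤ y.1 + y.2 ∧ y.1 + y.2 ≤ 1 then ∑ k ∈ Finset.Icc 1 6, (1 / (k.factorial : ℝ)) *
            cpow (fun t : ℝ => if (1651 / 10000 : ℝ) < t then 1 / t else 0) k (1 - (y.1 + y.2)) else 0) /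
            (y.1 * y.2)) y.swap =
    (fun y : ℝ × ℝ => (if 0 ≤ y.1 + y.2 ∧ y.1 + y.2 ≤ 1 then ∑ k ∈ Finset.Icc 1 6, (1 / (k.factorial : ℝ)) *
            cpow (fun t : ℝ => if (1651 / 10000 : ℝ) < t then 1 / t else 0) k (1 - (y.1 + y.2)) else 0) /
            (y.1 * y.2)) y := by
  simp only [Prod.fst_swap, Prod.snd_swap]
  rw [add_comm y.2 y.1, mul_comm y.2 y.1]

/-- `f` is integrable on `S_e`. [folklore] -/
theorem integrableOn_truncWeight_entrySq (e : ℕ × ℕ × ℕ × ℤ) :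
    IntegrableOn (fun y : ℝ × ℝ => (if 0 ≤ y.1 + y.2 ∧ y.1 + y.2 ≤ 1 then ∑ k ∈ Finset.Icc 1 6, (1 / (k.factorial : ℝ)) *
            cpow (fun t : ℝ => if (1651 / 10000 : ℝ) < t then 1 / t else 0) k (1 - (y.1 + y.2)) else 0) /
            (y.1 * y.2))
      {y : ℝ × ℝ | ((certEdge e.1 : ℚ) : ℝ) < y.1 ∧ y.1 < ((certEdge (e.1 + 1) : ℚ) : ℝ) ∧
      ((certEdge e.2.1 : ℚ) : ℝ) < y.2 ∧ y.2 < ((certEdge (e.2.1 + 1) : ℚ) : ℝ) ∧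
      (if e.2.2.1 = 0 then y.1 + y.2 < 8349 / 20000 else 8349 / 20000 < y.1 + y.2) ∧ y.1 + y.2 < 1 / 2} ((volume : Measure ℝ).prod volume) := by
  obtain ⟨hΨm, C, hΨC⟩ := truncPhi_measurable_bdd
  have hν : (0 : ℝ) < 1651 / 10000 := by norm_num
  exact (integrableOn_rect_Ico hΨm hΨC (b := 1) (d := 1) hν hν).mono_set (entrySq_subset e)

/-- `f` is integrable on `Q_e`. [folklore] -/
theorem integrableOn_truncWeight_entryQ (e : ℕ × ℕ × ℕ × ℤ) :
    IntegrableOn (fun y : ℝ × ℝ => (if 0 ≤ y.1 + y.2 ∧ y.1 + y.2 ≤ 1 then ∑ k ∈ Finset.Icc 1 6, (1 / (k.factorial : ℝ)) *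
            cpow (fun t : ℝ => if (1651 / 10000 : ℝ) < t then 1 / t else 0) k (1 - (y.1 + y.2)) else 0) /
            (y.1 * y.2))
      {y : ℝ × ℝ | ((certEdge e.1 : ℚ) : ℝ) < y.1 ∧ y.1 < ((certEdge (e.1 + 1) : ℚ) : ℝ) ∧
      ((certEdge e.2.1 : ℚ) : ℝ) < y.2 ∧ y.2 < ((certEdge (e.2.1 + 1) : ℚ) : ℝ) ∧
      y.1 ≤ y.2 ∧ (if e.2.2.1 = 0 then y.1 + y.2 < 8349 / 20000 else 8349 / 20000 < y.1 + y.2) ∧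
      y.1 + y.2 < 1 / 2} ((volume : Measure ℝ).prod volume) := by
  rw [entryQ_eq_inter]
  exact (integrableOn_truncWeight_entrySq e).mono_set Set.inter_subset_left

/-! ### The plane integral of an entry as `κ ∫_{Q_e} f` -/

/-- **The plane integral of `…PairingTwoPlane` is `κ · ∫_{Q_e} f`.** [folklore] -/
theorem plane_eq_mul_setIntegral (e : ℕ × ℕ × ℕ × ℤ) (κ : ℝ) :
    ∫ y : ℝ × ℝ, (if ((certEdge e.1 : ℚ) : ℝ) < y.1 ∧ y.1 < ((certEdge (e.1 + 1) : ℚ) : ℝ) ∧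
            ((certEdge e.2.1 : ℚ) : ℝ) < y.2 ∧ y.2 < ((certEdge (e.2.1 + 1) : ℚ) : ℝ) ∧
            y.1 ≤ y.2 ∧ (if e.2.2.1 = 0 then y.1 + y.2 < 8349 / 20000 else 8349 / 20000 < y.1 + y.2) ∧
            y.1 + y.2 < 1 / 2
        then κ * (∑ m ∈ Finset.Icc 1 6, (1 / (m.factorial : ℝ)) *
          cpow (fun t : ℝ => if (1651 / 10000 : ℝ) < t then 1 / t else 0) m (1 - (y.1 + y.2))) / (y.1 * y.2)
        else 0) ∂((volume : Measure ℝ).prod volume) =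
    κ * ∫ y in {y : ℝ × ℝ | ((certEdge e.1 : ℚ) : ℝ) < y.1 ∧ y.1 < ((certEdge (e.1 + 1) : ℚ) : ℝ) ∧
      ((certEdge e.2.1 : ℚ) : ℝ) < y.2 ∧ y.2 < ((certEdge (e.2.1 + 1) : ℚ) : ℝ) ∧
      y.1 ≤ y.2 ∧ (if e.2.2.1 = 0 then y.1 + y.2 < 8349 / 20000 else 8349 / 20000 < y.1 + y.2) ∧
      y.1 + y.2 < 1 / 2},
          (if 0 ≤ y.1 + y.2 ∧ y.1 + y.2 ≤ 1 then ∑ k ∈ Finset.Icc 1 6, (1 / (k.factorial : ℝ)) *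
            cpow (fun t : ℝ => if (1651 / 10000 : ℝ) < t then 1 / t else 0) k (1 - (y.1 + y.2)) else 0) /
            (y.1 * y.2) ∂((volume : Measure ℝ).prod volume) := by
  rw [← integral_const_mul, ← integral_indicator (measurableSet_entryQ e)]
  refine integral_congr_ae (Filter.Eventually.of_forall fun y => ?_)
  simp only [Set.indicator, Set.mem_setOf_eq]
  by_cases hy : ((certEdge e.1 : ℚ) : ℝ) < y.1 ∧ y.1 < ((certEdge (e.1 + 1) : ℚ) : ℝ) ∧
      ((certEdge e.2.1 : ℚ) : ℝ) < y.2 ∧ y.2 < ((certEdge (e.2.1 + 1) : ℚ) : ℝ) ∧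
      y.1 ≤ y.2 ∧ (if e.2.2.1 = 0 then y.1 + y.2 < 8349 / 20000 else 8349 / 20000 < y.1 + y.2) ∧
      y.1 + y.2 < 1 / 2
  · rw [if_pos hy, if_pos hy]
    have hy1 : (1651 / 10000 : ℝ) < y.1 := lt_of_le_of_lt (nu_le_certEdge e.1) hy.1
    have hy2 : (1651 / 10000 : ℝ) < y.2 := lt_of_le_of_lt (nu_le_certEdge e.2.1) hy.2.2.1
    have hs : 0 ≤ y.1 + y.2 ∧ y.1 + y.2 ≤ 1 := ⟨by linarith, by linarith [hy.2.2.2.2.2.2]⟩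
    rw [if_pos hs]
    ring
  · rw [if_neg hy, if_neg hy]

/-! ### `∫_{S_e} f = σ_e ∫_{Q_e} f` -/

/-- For `a < b` the constraint `y₁ ≤ y₂` is automatic: `S_e = Q_e`. [folklore] -/
theorem entrySq_eq_entryQ_of_lt {e : ℕ × ℕ × ℕ × ℤ} (hab : e.1 < e.2.1) (hb : e.2.1 ≤ 85) :
    {y : ℝ × ℝ | ((certEdge e.1 : ℚ) : ℝ) < y.1 ∧ y.1 < ((certEdge (e.1 + 1) : ℚ) : ℝ) ∧
      ((certEdge e.2.1 : ℚ) : ℝ) < y.2 ∧ y.2 < ((certEdge (e.2.1 + 1) : ℚ) : ℝ) ∧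
      (if e.2.2.1 = 0 then y.1 + y.2 < 8349 / 20000 else 8349 / 20000 < y.1 + y.2) ∧ y.1 + y.2 < 1 / 2} =
    {y : ℝ × ℝ | ((certEdge e.1 : ℚ) : ℝ) < y.1 ∧ y.1 < ((certEdge (e.1 + 1) : ℚ) : ℝ) ∧
      ((certEdge e.2.1 : ℚ) : ℝ) < y.2 ∧ y.2 < ((certEdge (e.2.1 + 1) : ℚ) : ℝ) ∧
      y.1 ≤ y.2 ∧ (if e.2.2.1 = 0 then y.1 + y.2 < 8349 / 20000 else 8349 / 20000 < y.1 + y.2) ∧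
      y.1 + y.2 < 1 / 2} := by
  rw [entryQ_eq_inter]
  refine (Set.inter_eq_left.2 fun y hy => ?_).symm
  simp only [Set.mem_setOf_eq] at hy ⊢
  have h := certEdge_cast_le (Nat.succ_le_of_lt hab) hb
  linarith [hy.2.1, hy.2.2.1]

/-- For `a = b` the region `S_e` is swap-invariant. [folklore] -/
theorem entrySq_swap {e : ℕ × ℕ × ℕ × ℤ} (haa : e.1 = e.2.1) (y : ℝ × ℝ) :
    y ∈ {y : ℝ × ℝ | ((certEdge e.1 : ℚ) : ℝ) < y.1 ∧ y.1 < ((certEdge (e.1 + 1) : ℚ) : ℝ) ∧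
      ((certEdge e.2.1 : ℚ) : ℝ) < y.2 ∧ y.2 < ((certEdge (e.2.1 + 1) : ℚ) : ℝ) ∧
      (if e.2.2.1 = 0 then y.1 + y.2 < 8349 / 20000 else 8349 / 20000 < y.1 + y.2) ∧ y.1 + y.2 < 1 / 2} ↔
    y.swap ∈ {y : ℝ × ℝ | ((certEdge e.1 : ℚ) : ℝ) < y.1 ∧ y.1 < ((certEdge (e.1 + 1) : ℚ) : ℝ) ∧
      ((certEdge e.2.1 : ℚ) : ℝ) < y.2 ∧ y.2 < ((certEdge (e.2.1 + 1) : ℚ) : ℝ) ∧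
      (if e.2.2.1 = 0 then y.1 + y.2 < 8349 / 20000 else 8349 / 20000 < y.1 + y.2) ∧ y.1 + y.2 < 1 / 2} := by
  simp only [Set.mem_setOf_eq, Prod.fst_swap, Prod.snd_swap, haa]
  rw [add_comm y.2 y.1]
  tauto

/-- **`∫_{S_e} f = σ_e · ∫_{Q_e} f`** for every table entry (`σ_e = 2` if `a = b`, else `1`). [folklore] -/
theorem setIntegral_entrySq_eq {e : ℕ × ℕ × ℕ × ℤ} (he : e ∈ certG2) :
    ∫ y in {y : ℝ × ℝ | ((certEdge e.1 : ℚ) : ℝ) < y.1 ∧ y.1 < ((certEdge (e.1 + 1) : ℚ) : ℝ) ∧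
      ((certEdge e.2.1 : ℚ) : ℝ) < y.2 ∧ y.2 < ((certEdge (e.2.1 + 1) : ℚ) : ℝ) ∧
      (if e.2.2.1 = 0 then y.1 + y.2 < 8349 / 20000 else 8349 / 20000 < y.1 + y.2) ∧ y.1 + y.2 < 1 / 2},
          (if 0 ≤ y.1 + y.2 ∧ y.1 + y.2 ≤ 1 then ∑ k ∈ Finset.Icc 1 6, (1 / (k.factorial : ℝ)) *
            cpow (fun t : ℝ => if (1651 / 10000 : ℝ) < t then 1 / t else 0) k (1 - (y.1 + y.2)) else 0) /
            (y.1 * y.2) ∂((volume : Measure ℝ).prod volume) =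
    (((if e.1 == e.2.1 then 2 else 1 : ℕ) : ℕ) : ℝ) * ∫ y in {y : ℝ × ℝ | ((certEdge e.1 : ℚ) : ℝ) < y.1 ∧ y.1 < ((certEdge (e.1 + 1) : ℚ) : ℝ) ∧
      ((certEdge e.2.1 : ℚ) : ℝ) < y.2 ∧ y.2 < ((certEdge (e.2.1 + 1) : ℚ) : ℝ) ∧
      y.1 ≤ y.2 ∧ (if e.2.2.1 = 0 then y.1 + y.2 < 8349 / 20000 else 8349 / 20000 < y.1 + y.2) ∧
      y.1 + y.2 < 1 / 2},
          (if 0 ≤ y.1 + y.2 ∧ y.1 + y.2 ≤ 1 then ∑ k ∈ Finset.Icc 1 6, (1 / (k.factorial : ℝ)) *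
            cpow (fun t : ℝ => if (1651 / 10000 : ℝ) < t then 1 / t else 0) k (1 - (y.1 + y.2)) else 0) /
            (y.1 * y.2) ∂((volume : Measure ℝ).prod volume) := by
  obtain ⟨hab, hb, -⟩ := certG2_le_of_mem he
  by_cases haa : e.1 = e.2.1
  · have hσ : (((if e.1 == e.2.1 then 2 else 1 : ℕ) : ℕ) : ℝ) = 2 := by simp [haa]
    rw [hσ, entryQ_eq_inter]
    exact setIntegral_symm_eq_two_mul (entrySq_swap haa) (fun y => truncWeight_swap y)
      (integrableOn_truncWeight_entrySq e)
  · have hσ : (((if e.1 == e.2.1 then 2 else 1 : ℕ) : ℕ) : ℝ) = 1 := by simp [haa]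
    rw [hσ, one_mul, entrySq_eq_entryQ_of_lt (lt_of_le_of_ne hab haa) (by omega)]

end Summit.Parity.GeneralizedHardyLittlewood.FordMaynardSieveConst01651SieveConst01651

end
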